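import Mathlib.Analysis.Calculus.Deriv.Shift
import Mathlib.Analysis.Complex.RealDeriv
import Literature.Probability.RandomPlanarGeometry.ConformalRemovabilityAnalytic
import Literature.Probability.RandomPlanarGeometry.ConformalRemovabilityLine
import HarnessLib

/-!
# Conformal removability from the two-point estimate (Jones–Smirnov, Prop. 1 ⇒ Thm. 1)

Support for the proof of `JonesSmirnov2000_frontier_of_isHolderDomain` (Jones–Smirnov 2000,
Cor. 2; `ConformalRemovability.lean`). In P. W. Jones, S. K. Smirnov, Ark. Mat. 38 (2000), §2,
Theorem 1 (quasiconformal removability of `K = ∂Ω`) is deduced from Proposition 1 on pp. 269–270: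
the estimate (10)/(11) on almost every line parallel to the axes makes a map that is Sobolev off
`K` absolutely continuous on lines, and "ACL + quasiconformal a.e." is quasiconformal. This file
assembles the conformal version of that deduction from the two previous files:

* `IsConformallyRemovableIn.of_twoPoint` — let `U ⊆ ℂ` be open and `K` closed of area zero.
  Suppose that for every `F` continuous and injective on `U` and holomorphic on `U ∖ K`, on almost
  every horizontal line and on almost every vertical line the TWO-POINT ESTIMATE
  `‖F x' - F x‖ ≤ ∫_{[x,x']} ‖F'‖` holds for all pairs of points `x, x'` of `K` on the line whose
  segment lies in `U` (the conclusion of Proposition 1, estimate (10) p. 272 with the shadow term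
  sent to zero, p. 273). Then `K` is conformally removable inside `U`.
  Proof: `deriv F ∈ L¹` on rectangles (`integrableOn_deriv_rectangle`), so on a.e. line of a
  rectangle the slice of `deriv F` is integrable and the slice of `K` is null (Fubini); the line
  lemma `sub_eq_integral_of_norm_sub_le_integral` turns the two-point estimate into the
  fundamental theorem of calculus along that line, and `differentiableOn_of_rect_lineIdentities`
  (Fubini + Morera) gives holomorphy.
* `ae_volume_hSlice_eq_zero`, `ae_volume_vSlice_eq_zero` — a.e. horizontal/vertical slice of a
  null set is null.

What remains for Cor. 2 is exactly the geometric half of the paper: the two-point estimate on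
a.e. line for `K = ∂Ω`, `Ω` a Hölder domain (Whitney squares, shadows, condition (1)).

## References

* [JonesSmirnov2000] P. W. Jones, S. K. Smirnov, *Removability theorems for Sobolev functions and
  quasiconformal maps*, Ark. Mat. 38 (2000) 263–279, §2, pp. 269–273.
-/

noncomputable section

open Set Filter Metric MeasureTheory Complex intervalIntegral
open scoped Topology Interval ENNReal

namespace Literature.Probability.RandomPlanarGeometry

variable {U K : Set ℂ}

/-! ### Slices of null sets and of integrable functions -/

/-- Almost every horizontal slice of a Lebesgue-null measurable set `K ⊆ ℂ` is null (Tonelli).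
[folklore] -/
theorem ae_volume_hSlice_eq_zero (hKm : MeasurableSet K) (hK0 : volume K = 0) :
    ∀ᵐ y : ℝ, volume {x : ℝ | (x : ℂ) + y * I ∈ K} = 0 := by
  have hmeas : MeasurableSet (measurableEquivRealProd.symm ⁻¹' K) :=
    measurableEquivRealProd.symm.measurable hKm
  have hK' : volume (measurableEquivRealProd.symm ⁻¹' K) = 0 := by
    rw [(volume_preserving_equiv_real_prod.symm _).measure_preimage hKm.nullMeasurableSet, hK0]
  rw [Measure.volume_eq_prod, Measure.prod_apply_symm hmeas,
    lintegral_eq_zero_iff (measurable_measure_prodMk_right hmeas)] at hK'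
  filter_upwards [hK'] with y hy
  rw [Pi.zero_apply] at hy
  convert hy using 2
  ext x
  simp only [mem_setOf_eq, mem_preimage, measurableEquivRealProd_symm_apply, mk_eq_add_mul_I]

/-- Almost every vertical slice of a Lebesgue-null measurable set `K ⊆ ℂ` is null (Tonelli).
[folklore] -/
theorem ae_volume_vSlice_eq_zero (hKm : MeasurableSet K) (hK0 : volume K = 0) :
    ∀ᵐ x : ℝ, volume {y : ℝ | (x : ℂ) + y * I ∈ K} = 0 := by
  have hmeas : MeasurableSet (measurableEquivRealProd.symm ⁻¹' K) :=
    measurableEquivRealProd.symm.measurable hKm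
  have hK' : volume (measurableEquivRealProd.symm ⁻¹' K) = 0 := by
    rw [(volume_preserving_equiv_real_prod.symm _).measure_preimage hKm.nullMeasurableSet, hK0]
  rw [Measure.volume_eq_prod, Measure.prod_apply hmeas,
    lintegral_eq_zero_iff (measurable_measure_prodMk_left hmeas)] at hK'
  filter_upwards [hK'] with x hx
  rw [Pi.zero_apply] at hx
  convert hx using 2
  ext y
  simp only [mem_setOf_eq, mem_preimage, measurableEquivRealProd_symm_apply, mk_eq_add_mul_I]

/-- A function integrable on a closed rectangle of `ℂ` is integrable on the corresponding product
of intervals of `ℝ × ℝ`, in the coordinates `(x, y) ↦ x + y i`. [folklore] -/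
theorem integrable_prod_of_integrableOn_rectangle {G : ℂ → ℂ} {z w : ℂ}
    (hG : IntegrableOn G (Rectangle z w)) :
    Integrable (fun p : ℝ × ℝ => G (p.1 + p.2 * I))
      ((volume.restrict [[z.re, w.re]]).prod (volume.restrict [[z.im, w.im]])) := by
  rw [Measure.prod_restrict, ← Measure.volume_eq_prod]
  have hG' := hG
  rw [← (volume_preserving_equiv_real_prod.symm _).integrableOn_comp_preimage
    (MeasurableEquiv.measurableEmbedding _)] at hG'
  refine (hG'.mono_set ?_).congr_fun (fun p _ => ?_) (measurableSet_uIcc.prod measurableSet_uIcc)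
  · intro p hp
    exact mem_reProdIm.2 ⟨hp.1, hp.2⟩
  · show G (measurableEquivRealProd.symm p) = G (p.1 + p.2 * I)
    rw [measurableEquivRealProd_symm_apply, mk_eq_add_mul_I]

/-! ### Removability from the two-point estimate -/

/-- **Conformal removability from the two-point estimate** (Jones–Smirnov 2000, §2,
"Proposition 1 implies Theorem 1", pp. 269–270, conformal planar case). Let `U` be open, `K`
closed with `area K = 0`, and suppose that every `F` continuous and injective on `U` and
holomorphic on `U ∖ K` satisfies, on almost every horizontal and almost every vertical line, the
two-point estimate `‖F x' - F x‖ ≤ ∫_{[x, x']} ‖F'‖` for all points `x, x'` of `K` on the line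
whose segment lies in `U` (estimate (10), p. 272, in the limit of small Whitney cubes, p. 273).
Then `K` is conformally removable inside `U`: slices of `deriv F ∈ L¹(R)`
(`integrableOn_deriv_rectangle`) and of `K` are integrable, resp. null, on a.e. line (Fubini); the
line lemma gives the fundamental theorem of calculus on a.e. line of every rectangle `R ⊆ U`; and
the analytic definition (`differentiableOn_of_rect_lineIdentities`) gives holomorphy.
[cite: JonesSmirnov2000, §2 pp. 269–270] -/
theorem IsConformallyRemovableIn.of_twoPoint (hU : IsOpen U) (hK : IsClosed K)
    (hK0 : volume K = 0)
    (h : ∀ F : ℂ → ℂ, ContinuousOn F U → InjOn F U → DifferentiableOn ℂ F (U \ K) →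
      (∀ᵐ y : ℝ, ∀ x x' : ℝ, x ≤ x' → (∀ t ∈ Icc x x', (t : ℂ) + y * I ∈ U) →
          (x : ℂ) + y * I ∈ K → (x' : ℂ) + y * I ∈ K →
          ‖F (x' + y * I) - F (x + y * I)‖ ≤ ∫ t in x..x', ‖deriv F (t + y * I)‖) ∧
      (∀ᵐ x : ℝ, ∀ y y' : ℝ, y ≤ y' → (∀ t ∈ Icc y y', (x : ℂ) + t * I ∈ U) →
          (x : ℂ) + y * I ∈ K → (x : ℂ) + y' * I ∈ K →
          ‖F (x + y' * I) - F (x + y * I)‖ ≤ ∫ t in y..y', ‖deriv F (x + t * I)‖)) :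
    IsConformallyRemovableIn U K := by
  intro F hFc hFi hFd
  obtain ⟨hH, hV⟩ := h F hFc hFi hFd
  have hUK : IsOpen (U \ K) := hU.sdiff hK
  refine differentiableOn_of_rect_lineIdentities (F' := deriv F) hU hFc fun z w hR => ?_
  have hint : IntegrableOn (deriv F) (Rectangle z w) :=
    integrableOn_deriv_rectangle hU hK hK0 hFc hFi hFd hR
  have hG := integrable_prod_of_integrableOn_rectangle hint
  have hmem : ∀ x ∈ [[z.re, w.re]], ∀ y ∈ [[z.im, w.im]], (x : ℂ) + y * I ∈ U :=
    fun x hx y hy => hR (ofReal_add_mul_I_mem_rectangle hx hy)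
  refine ⟨hint, ?_, ?_⟩
  · -- horizontal identities on a.e. horizontal line of the rectangle
    have hint' : ∀ᵐ y : ℝ, y ∈ [[z.im, w.im]] →
        IntervalIntegrable (fun x : ℝ => deriv F (x + y * I)) volume z.re w.re := by
      have := hG.prod_left_ae
      rw [ae_restrict_iff' measurableSet_uIcc] at this
      filter_upwards [this] with y hy hymem
      exact MeasureTheory.IntegrableOn.intervalIntegrable (hy hymem)
    filter_upwards [hH, ae_volume_hSlice_eq_zero hK.measurableSet hK0, hint'] with y hy hy0 hyi
      hymem
    -- the line lemma on `[[re z, re w]]`, in either orientation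
    have key : ∀ a b : ℝ, a ≤ b → [[a, b]] = [[z.re, w.re]] →
        IntervalIntegrable (fun x : ℝ => deriv F (x + y * I)) volume a b →
        F (b + y * I) - F (a + y * I) = ∫ x in a..b, deriv F (x + y * I) := by
      intro a b hab huIcc hi
      have hmem' : ∀ x ∈ Icc a b, (x : ℂ) + y * I ∈ U := fun x hx =>
        hmem x (by rw [← huIcc, uIcc_of_le hab]; exact hx) y hymem
      refine sub_eq_integral_of_norm_sub_le_integral (f := fun x : ℝ => F (x + y * I))
        (f' := fun x : ℝ => deriv F (x + y * I)) (C := {x : ℝ | (x : ℂ) + y * I ∈ K}) hab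
        (hK.preimage (continuous_ofReal.add continuous_const)) hy0
        (hFc.comp (continuous_ofReal.add continuous_const).continuousOn hmem') ?_ hi ?_
      · rintro x ⟨hx, hxK⟩
        have hxU : (x : ℂ) + y * I ∈ U \ K := ⟨hmem' x (Ioo_subset_Icc_self hx), hxK⟩
        have hFx : HasDerivAt F (deriv F (x + y * I)) (x + y * I) :=
          (hFd.differentiableAt (hUK.mem_nhds hxU)).hasDerivAt
        exact (HasDerivAt.comp_add_const (x : ℂ) (y * I) hFx).comp_ofReal
      · rintro x ⟨hxK, hxab⟩ x' ⟨hx'K, hx'ab⟩ hxx'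
        exact hy x x' hxx' (fun t ht => hmem' t ⟨hxab.1.trans ht.1, ht.2.trans hx'ab.2⟩) hxK hx'K
    rcases le_total z.re w.re with hzw | hzw
    · exact key z.re w.re hzw rfl (hyi hymem)
    · have := key w.re z.re hzw (uIcc_comm _ _) (hyi hymem).symm
      rw [integral_symm, ← this]
      abel
  · -- vertical identities on a.e. vertical line of the rectangle
    have hint' : ∀ᵐ x : ℝ, x ∈ [[z.re, w.re]] →
        IntervalIntegrable (fun y : ℝ => deriv F (x + y * I)) volume z.im w.im := by
      have := hG.prod_right_ae
      rw [ae_restrict_iff' measurableSet_uIcc] at this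
      filter_upwards [this] with x hx hxmem
      exact MeasureTheory.IntegrableOn.intervalIntegrable (hx hxmem)
    filter_upwards [hV, ae_volume_vSlice_eq_zero hK.measurableSet hK0, hint'] with x hx hx0 hxi
      hxmem
    have key : ∀ c d : ℝ, c ≤ d → [[c, d]] = [[z.im, w.im]] →
        IntervalIntegrable (fun y : ℝ => deriv F (x + y * I)) volume c d →
        F (x + d * I) - F (x + c * I) = I * ∫ y in c..d, deriv F (x + y * I) := by
      intro c d hcd huIcc hi
      have hmem' : ∀ t ∈ Icc c d, (x : ℂ) + t * I ∈ U := fun t ht =>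
        hmem x hxmem t (by rw [← huIcc, uIcc_of_le hcd]; exact ht)
      have hline := sub_eq_integral_of_norm_sub_le_integral (f := fun t : ℝ => F (x + t * I))
        (f' := fun t : ℝ => deriv F (x + t * I) * I) (C := {t : ℝ | (x : ℂ) + t * I ∈ K}) hcd
        (hK.preimage (continuous_const.add (continuous_ofReal.mul continuous_const))) hx0
        (hFc.comp (continuous_const.add (continuous_ofReal.mul continuous_const)).continuousOn
          hmem') ?_ (hi.mul_const I) ?_
      · rw [hline, intervalIntegral.integral_mul_const, mul_comm]
      · rintro t ⟨ht, htK⟩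
        have htU : (x : ℂ) + t * I ∈ U \ K := ⟨hmem' t (Ioo_subset_Icc_self ht), htK⟩
        have hFt : HasDerivAt F (deriv F (x + t * I)) (x + t * I) :=
          (hFd.differentiableAt (hUK.mem_nhds htU)).hasDerivAt
        have hlin : HasDerivAt (fun s : ℂ => (x : ℂ) + s * I) I (t : ℂ) := by
          simpa using ((hasDerivAt_id (t : ℂ)).mul_const I).const_add (x : ℂ)
        exact (hFt.comp (t : ℂ) hlin).comp_ofReal
      · rintro t ⟨htK, htcd⟩ t' ⟨ht'K, ht'cd⟩ htt'
        have := hx t t' htt' (fun s hs => hmem' s ⟨htcd.1.trans hs.1, hs.2.trans ht'cd.2⟩) htK ht'K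
        simpa only [norm_mul, norm_I, mul_one] using this
    rcases le_total z.im w.im with hzw | hzw
    · exact key z.im w.im hzw rfl (hxi hxmem)
    · have := key w.im z.im hzw (uIcc_comm _ _) (hxi hxmem).symm
      rw [integral_symm, mul_neg, ← this]
      abel

/-- **Conformal removability from the two-point estimate, sharpened form.** As `of_twoPoint`, but
the two-point estimate on a line is only required when, in addition, the slice of `K` by that
line is null and `deriv F` is integrable on the segment — both hold on almost every line of every
rectangle of `U` (Fubini), so this is what the proof of `of_twoPoint` actually uses; the geometric
half of Jones–Smirnov's argument (Prop. 1, pp. 270–272) produces the estimate exactly on such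
lines. [cite: JonesSmirnov2000, §2 pp. 269–272] -/
theorem IsConformallyRemovableIn.of_twoPoint' (hU : IsOpen U) (hK : IsClosed K)
    (hK0 : volume K = 0)
    (h : ∀ F : ℂ → ℂ, ContinuousOn F U → InjOn F U → DifferentiableOn ℂ F (U \ K) →
      (∀ᵐ y : ℝ, volume {t : ℝ | (t : ℂ) + y * I ∈ K} = 0 →
          ∀ x x' : ℝ, x ≤ x' → (∀ t ∈ Icc x x', (t : ℂ) + y * I ∈ U) →
          IntervalIntegrable (fun t : ℝ => deriv F (t + y * I)) volume x x' →
          (x : ℂ) + y * I ∈ K → (x' : ℂ) + y * I ∈ K →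
          ‖F (x' + y * I) - F (x + y * I)‖ ≤ ∫ t in x..x', ‖deriv F (t + y * I)‖) ∧
      (∀ᵐ x : ℝ, volume {t : ℝ | (x : ℂ) + t * I ∈ K} = 0 →
          ∀ y y' : ℝ, y ≤ y' → (∀ t ∈ Icc y y', (x : ℂ) + t * I ∈ U) →
          IntervalIntegrable (fun t : ℝ => deriv F (x + t * I)) volume y y' →
          (x : ℂ) + y * I ∈ K → (x : ℂ) + y' * I ∈ K →
          ‖F (x + y' * I) - F (x + y * I)‖ ≤ ∫ t in y..y', ‖deriv F (x + t * I)‖)) :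
    IsConformallyRemovableIn U K := by
  intro F hFc hFi hFd
  obtain ⟨hH, hV⟩ := h F hFc hFi hFd
  have hUK : IsOpen (U \ K) := hU.sdiff hK
  refine differentiableOn_of_rect_lineIdentities (F' := deriv F) hU hFc fun z w hR => ?_
  have hint : IntegrableOn (deriv F) (Rectangle z w) :=
    integrableOn_deriv_rectangle hU hK hK0 hFc hFi hFd hR
  have hG := integrable_prod_of_integrableOn_rectangle hint
  have hmem : ∀ x ∈ [[z.re, w.re]], ∀ y ∈ [[z.im, w.im]], (x : ℂ) + y * I ∈ U :=
    fun x hx y hy => hR (ofReal_add_mul_I_mem_rectangle hx hy)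
  refine ⟨hint, ?_, ?_⟩
  · -- horizontal identities on a.e. horizontal line of the rectangle
    have hint' : ∀ᵐ y : ℝ, y ∈ [[z.im, w.im]] →
        IntervalIntegrable (fun x : ℝ => deriv F (x + y * I)) volume z.re w.re := by
      have := hG.prod_left_ae
      rw [ae_restrict_iff' measurableSet_uIcc] at this
      filter_upwards [this] with y hy hymem
      exact MeasureTheory.IntegrableOn.intervalIntegrable (hy hymem)
    filter_upwards [hH, ae_volume_hSlice_eq_zero hK.measurableSet hK0, hint'] with y hy hy0 hyi
      hymem
    -- the line lemma on `[[re z, re w]]`, in either orientation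
    have key : ∀ a b : ℝ, a ≤ b → [[a, b]] = [[z.re, w.re]] →
        IntervalIntegrable (fun x : ℝ => deriv F (x + y * I)) volume a b →
        F (b + y * I) - F (a + y * I) = ∫ x in a..b, deriv F (x + y * I) := by
      intro a b hab huIcc hi
      have hmem' : ∀ x ∈ Icc a b, (x : ℂ) + y * I ∈ U := fun x hx =>
        hmem x (by rw [← huIcc, uIcc_of_le hab]; exact hx) y hymem
      refine sub_eq_integral_of_norm_sub_le_integral (f := fun x : ℝ => F (x + y * I))
        (f' := fun x : ℝ => deriv F (x + y * I)) (C := {x : ℝ | (x : ℂ) + y * I ∈ K}) hab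
        (hK.preimage (continuous_ofReal.add continuous_const)) hy0
        (hFc.comp (continuous_ofReal.add continuous_const).continuousOn hmem') ?_ hi ?_
      · rintro x ⟨hx, hxK⟩
        have hxU : (x : ℂ) + y * I ∈ U \ K := ⟨hmem' x (Ioo_subset_Icc_self hx), hxK⟩
        have hFx : HasDerivAt F (deriv F (x + y * I)) (x + y * I) :=
          (hFd.differentiableAt (hUK.mem_nhds hxU)).hasDerivAt
        exact (HasDerivAt.comp_add_const (x : ℂ) (y * I) hFx).comp_ofReal
      · rintro x ⟨hxK, hxab⟩ x' ⟨hx'K, hx'ab⟩ hxx'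
        refine hy hy0 x x' hxx' (fun t ht => hmem' t ⟨hxab.1.trans ht.1, ht.2.trans hx'ab.2⟩)
          (hi.mono_set ?_) hxK hx'K
        rw [uIcc_of_le hab, uIcc_of_le hxx']
        exact Icc_subset_Icc hxab.1 hx'ab.2
    rcases le_total z.re w.re with hzw | hzw
    · exact key z.re w.re hzw rfl (hyi hymem)
    · have := key w.re z.re hzw (uIcc_comm _ _) (hyi hymem).symm
      rw [integral_symm, ← this]
      abel
  · -- vertical identities on a.e. vertical line of the rectangle
    have hint' : ∀ᵐ x : ℝ, x ∈ [[z.re, w.re]] →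
        IntervalIntegrable (fun y : ℝ => deriv F (x + y * I)) volume z.im w.im := by
      have := hG.prod_right_ae
      rw [ae_restrict_iff' measurableSet_uIcc] at this
      filter_upwards [this] with x hx hxmem
      exact MeasureTheory.IntegrableOn.intervalIntegrable (hx hxmem)
    filter_upwards [hV, ae_volume_vSlice_eq_zero hK.measurableSet hK0, hint'] with x hx hx0 hxi
      hxmem
    have key : ∀ c d : ℝ, c ≤ d → [[c, d]] = [[z.im, w.im]] →
        IntervalIntegrable (fun y : ℝ => deriv F (x + y * I)) volume c d →
        F (x + d * I) - F (x + c * I) = I * ∫ y in c..d, deriv F (x + y * I) := by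
      intro c d hcd huIcc hi
      have hmem' : ∀ t ∈ Icc c d, (x : ℂ) + t * I ∈ U := fun t ht =>
        hmem x hxmem t (by rw [← huIcc, uIcc_of_le hcd]; exact ht)
      have hline := sub_eq_integral_of_norm_sub_le_integral (f := fun t : ℝ => F (x + t * I))
        (f' := fun t : ℝ => deriv F (x + t * I) * I) (C := {t : ℝ | (x : ℂ) + t * I ∈ K}) hcd
        (hK.preimage (continuous_const.add (continuous_ofReal.mul continuous_const))) hx0
        (hFc.comp (continuous_const.add (continuous_ofReal.mul continuous_const)).continuousOn
          hmem') ?_ (hi.mul_const I) ?_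
      · rw [hline, intervalIntegral.integral_mul_const, mul_comm]
      · rintro t ⟨ht, htK⟩
        have htU : (x : ℂ) + t * I ∈ U \ K := ⟨hmem' t (Ioo_subset_Icc_self ht), htK⟩
        have hFt : HasDerivAt F (deriv F (x + t * I)) (x + t * I) :=
          (hFd.differentiableAt (hUK.mem_nhds htU)).hasDerivAt
        have hlin : HasDerivAt (fun s : ℂ => (x : ℂ) + s * I) I (t : ℂ) := by
          simpa using ((hasDerivAt_id (t : ℂ)).mul_const I).const_add (x : ℂ)
        exact (hFt.comp (t : ℂ) hlin).comp_ofReal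
      · rintro t ⟨htK, htcd⟩ t' ⟨ht'K, ht'cd⟩ htt'
        have hi' : IntervalIntegrable (fun y : ℝ => deriv F (x + y * I)) volume t t' := by
          refine hi.mono_set ?_
          rw [uIcc_of_le hcd, uIcc_of_le htt']
          exact Icc_subset_Icc htcd.1 ht'cd.2
        have := hx hx0 t t' htt' (fun s hs => hmem' s ⟨htcd.1.trans hs.1, hs.2.trans ht'cd.2⟩)
          hi' htK ht'K
        simpa only [norm_mul, norm_I, mul_one] using this
    rcases le_total z.im w.im with hzw | hzw
    · exact key z.im w.im hzw rfl (hxi hxmem)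
    · have := key w.im z.im hzw (uIcc_comm _ _) (hxi hxmem).symm
      rw [integral_symm, mul_neg, ← this]
      abel

end Literature.Probability.RandomPlanarGeometry
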